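/-
Copyright (c) 2026 the pub-hodgecm-mathlib formalisation cell (harness21).  Prover seat hodgecm-mathlib-K2E1-p16 (g2), Track B «K2-LIT» ENGINE E1, h413 = `stmt-HodgeConjecture-24833`,
route `HCCMUnconditional`, R90-S8 «ContSpec-n½» TWIN-DAG row 10 (dealer R90-CS-plan (g2), S8-R19) — the `N = 3` twin of ★ `K2E1ChiScatteringScalarPackageM1CMTwo` (K2E4∕K2E1): THE
SCATTERING SCALAR `s := qc default` AT THE SINGLETON BASIS OF `V(χ, K_max, 1)` on `U(2,1)_{L∕L⁺}`.
-/
import Summits.HodgeConjecture.HodgeConjecture.Theorems.K2E1ChiEisensteinM1FamilyExportCMThree    -- ★ row 9 (this seat): `chiEisenstein_family_export_maximalLevel_cm_three` (★ row 8 M1 print + families)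
import Summits.HodgeConjecture.HodgeConjecture.Theorems.K2E1ChiScatteringScalarPackageM1CMTwo    -- ★ (K2E1-p14): §1 every-rank `finrank_chiSectionSpace_maximalLevel_le_one_cm`, `exists_basis_singleton_selfDual_maximalLevel_cm` (reused BY IMPORT)
import Summits.HodgeConjecture.HodgeConjecture.Theorems.K2E1HeightFunctionU3                    -- ★ `borelHeight_one` (`H(1) = 1`, every `N`)
import HarnessLib

/-!
# h413 ∕ Track B «K2-LIT», R90-S8 TWIN-DAG row 10 — `K2E1ChiScatteringScalarPackageM1CMThree`: THE SCATTERING SCALAR `s := qc default` AT THE SINGLETON BASIS OF `V(χ, K_max, 1)` ON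
# `U(2,1)_{L∕L⁺}` — the (s,P)-PACKAGE BRIDGE «★ row 9 M1 family print ⇒ ∃ s P scalar package» at `N = 3`

Cell `pub/hodgecm-mathlib`, crux H413 = `stmt-HodgeConjecture-24833`; dealer R90-CS-plan (g2) S8-R19; TWIN-DAG v1 row 10 (this seat).  THEOREMS ONLY (no `def`, no `instance`, no
`notation`, no named-fact hypothesis, no `sorry`); lane `--kind proof --supports stmt-HodgeConjecture-24833 --as helper` (count-neutral).  The token-for-token `N = 3` twin of ★
`K2E1ChiScatteringScalarPackageM1CMTwo` §2–§3 (`2 ↦ 3`, `{1 < Re} ↦ {2 < Re}`, `H^{z−1} ↦ H^{z−2}`, `P ⊆ {Re ≤ 2}`, families `∀ n ≥ 1`); §1 there (`dim V(χ, K_max, ω) ≤ 1`, the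
singleton basis — EVERY RANK `N`, adelic Iwasawa) is reused BY IMPORT: at `N = 3` the `K_max`-spherical `χ`-sections again form a LINE (★ `finrank_chiSectionSpace_maximalLevel_le_one_cm`).

THE MATHEMATICS [MoeglinWaldspurger1995, I.2.17, II.1.7, IV.1.10; GetzHahn2024, Thm. 2.7.1].  Reading the scattering-coordinate identity `Σ_j q_j(z)·b_j = (ν𝓕)⁻¹·φ̃_z·H^{z−2}` of the ★
row 8∕9 M1 print at `g = 1` (`H(1) = 1`, ★ `borelHeight_one`) for a singleton index gives THE SCALAR CURRENCY `qc default z = (ν𝓕)⁻¹·(b(1))⁻¹·∫_N f_z^φ(w₀·v·1) dν` on `{2 < Re}` (§2,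
hypothesis-first on the print's clause letters), and §3 is the LETTER-FREE M1 PRINT: ONE call of ★ row 9 `chiEisenstein_family_export_maximalLevel_cm_three` at the singleton basis `{φ}`
of `V(χʷ, K_max, 1)` for a SELF-DUAL `χ` — the scalar `s := qc default`, its pole set `P`, `E(f_z^φ)` continued, the families (`∀ n ≥ 1`), AND the tube formula, all tied to the same
`(Ec, qc, P)`.
HONEST LABEL: HC_CM is proved only modulo the 7 printed citations (2 remaining named inputs: hLiu418 = `stmt-HodgeConjecture-24832`, h413 = `stmt-HodgeConjecture-24833`) until rung 0
closes; count-neutral helper, closes no socket.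

## References
* [MoeglinWaldspurger1995] C. Mœglin, J.-L. Waldspurger, *Spectral Decomposition and Eisenstein Series* (1995), I.2.17, II.1.7, IV.1.10.
* [GetzHahn2024] J. Getz, H. Hahn, *An Introduction to Automorphic Representations* (2024), Thm. 2.7.1 (Iwasawa decomposition).
* [BernsteinLapid2019] J. Bernstein, E. Lapid, *On the meromorphic continuation of Eisenstein series*, J. Amer. Math. Soc. 37 (2024), Thm 2.3.
-/

set_option autoImplicit false
-- the mandated namespace repeats `HodgeConjecture.HodgeConjecture`, as in every `Theorems/*.lean` of this sub-problem
set_option linter.dupNamespace false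

noncomputable section

open MeasureTheory Measure Filter Topology Set NumberField IsDedekindDomain
open scoped NNReal ENNReal
open Literature.MeasureTheory.Group Literature.NumberTheory Literature.NumberTheory.Automorphic Literature.NumberTheory.Automorphic.UnitaryGroup AdelicGroupData
open Literature.NumberTheory.Automorphic.Arthur2013.Leaves.TECR
open Literature.NumberTheory.GaloisRepresentations (HeckeCharacter)
open Summit.HodgeConjecture.HodgeConjecture.Cruxes.H413.K2E1BorelEisensteinU
open Summit.HodgeConjecture.HodgeConjecture.Cruxes.H413.K2E1BLBorelSpacesU2Defs
open Summit.HodgeConjecture.HodgeConjecture.Cruxes.H413.K2E1BLBorelOperatorsU2Defs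
open Summit.HodgeConjecture.HodgeConjecture.Cruxes.H413.K2E1CharacterEisensteinU2Defs
open Summit.HodgeConjecture.HodgeConjecture.Cruxes.H413.K2E1ChiSectionSpaceU2Defs
open Summit.HodgeConjecture.HodgeConjecture.Cruxes.H413.K2E1HeightFunctionU3 (borelHeight_one)
open Summit.HodgeConjecture.HodgeConjecture.Cruxes.H413.K2E1ChiEisensteinM1FamilyExportCMThree (chiEisenstein_family_export_maximalLevel_cm_three)
open Summit.HodgeConjecture.HodgeConjecture.Cruxes.H413.K2E1ChiScatteringScalarPackageM1CMTwo (exists_basis_singleton_selfDual_maximalLevel_cm)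

namespace Summit.HodgeConjecture.HodgeConjecture.Cruxes.H413.K2E1ChiScatteringScalarPackageM1CMThree

variable (L : Type) [Field L] [NumberField L] [IsCMField L]

/-! ## §1 (`dim V(χ, K_max, ω) ≤ 1` and the singleton basis, every rank `N`) is ★ `K2E1ChiScatteringScalarPackageM1CMTwo` §1, reused BY IMPORT -/

variable [MeasurableSpace (quasiSplit (↥(maximalRealSubfield L)) L (IsCMField.complexConj L) 3).Adelic] [BorelSpace (quasiSplit (↥(maximalRealSubfield L)) L (IsCMField.complexConj L) 3).Adelic]

omit [BorelSpace (quasiSplit (↥(maximalRealSubfield L)) L (IsCMField.complexConj L) 3).Adelic] in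
/-- **THE TUBE FORMULA OF THE SCATTERING SCALAR `s := qc default`** (hypothesis-first): for a singleton index (`[Unique ι']`) the ★ M1 print's clauses `hqφ` (`Σ_j q_j(z)·b_j =
(ν𝓕)⁻¹·φ̃_z·H^{z−2}`) and `hqcq` (`qc_j = q_j` on the tube), read at `g = 1` (`H(1) = 1`, ★ `borelHeight_one`) and divided by `b(1) ≠ 0`, give EXACTLY the `hs` letter of the
`N = 3` (SD) M1 road with `r := (ν𝓕).toReal⁻¹`, `φ' := b default`. [cite: MoeglinWaldspurger1995, II.1.7, IV.1.10] -/
theorem scatteringScalar_tube_of_coords_three (ν : Measure ↥(adelicUnipotent (↥(maximalRealSubfield L)) L (IsCMField.complexConj L) 3)) {𝓕 : Set ↥(adelicUnipotent (↥(maximalRealSubfield L)) L (IsCMField.complexConj L) 3)} {φ : (quasiSplit (↥(maximalRealSubfield L)) L (IsCMField.complexConj L) 3).Adelic → ℂ}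
    {ι' : Type} [Fintype ι'] [Unique ι'] (b : ι' → (quasiSplit (↥(maximalRealSubfield L)) L (IsCMField.complexConj L) 3).Adelic → ℂ) {q qc : ι' → ℂ → ℂ}
    (hqφ : ∀ z : ℂ, 2 < z.re → (∑ j, q j z • b j) = ((((ν 𝓕).toReal⁻¹ : ℝ)) : ℂ) • (fun g : (quasiSplit (↥(maximalRealSubfield L)) L (IsCMField.complexConj L) 3).Adelic => (∫ v : ↥(adelicUnipotent (↥(maximalRealSubfield L)) L (IsCMField.complexConj L) 3), flatSectionU φ z ((quasiSplit (↥(maximalRealSubfield L)) L (IsCMField.complexConj L) 3).toAdelic (weylLongU ((IsCMField.complexConj L : L ≃ₐ[↥(maximalRealSubfield L)] L) : L →+* L) (rfl : (StdForm.antidiagonal 3).over L = (StdForm.antidiagonal 3).over L)) * ((v : (quasiSplit (↥(maximalRealSubfield L)) L (IsCMField.complexConj L) 3).Adelic) * g)) ∂ν) * (((borelHeight g : ℝ) : ℂ) ^ (z - 2))))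
    (hqcq : ∀ j (z : ℂ), 2 < z.re → qc j z = q j z) (hb1 : b default 1 ≠ 0) :
    ∀ z : ℂ, 2 < z.re → qc default z = (((ν 𝓕).toReal⁻¹ : ℝ) : ℂ) * ((b default 1)⁻¹ * ∫ v : ↥(adelicUnipotent (↥(maximalRealSubfield L)) L (IsCMField.complexConj L) 3), flatSectionU φ z
        ((quasiSplit (↥(maximalRealSubfield L)) L (IsCMField.complexConj L) 3).toAdelic (weylLongU (IsCMField.complexConj L : L →+* L)
          (rfl : (StdForm.antidiagonal 3).over L = (StdForm.antidiagonal 3).over L)) * ((v : (quasiSplit (↥(maximalRealSubfield L)) L (IsCMField.complexConj L) 3).Adelic) * 1)) ∂ν) := by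
  intro z hz
  have h := congr_fun (hqφ z hz) 1
  simp only [Finset.sum_apply, Pi.smul_apply, smul_eq_mul, Fintype.sum_unique, borelHeight_one, NNReal.coe_one, Complex.ofReal_one,
    Complex.one_cpow, mul_one] at h
  simp only [mul_one, hqcq _ z hz]
  rw [← mul_inv_cancel_right₀ hb1 (q default z), h]
  ring

/-! ## §3 The letter-free M1 print at the singleton basis of a self-dual `χ` -/

/-- **THE (s,P)-PACKAGE AT M1 FOR A SELF-DUAL `χ` — LETTER-FREE**: for `χʷ = χ`, `φ ∈ V(χ, K_max, 1)` continuous bounded with `φ ∘ ι_∞ = φ(1)` and `φ(1) ≠ 0`, there are the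
singleton basis `bV = {φ}` of `V(χʷ, K_max, 1)`, scattering coordinates `q`, the continuation `Ec` of `E(f_z^φ)`, the scattering scalar `qc default` and ONE pole set `P` with ALL
clauses of ★ `chiEisenstein_family_export_maximalLevel_cm_three` (★ M1 print (E1)–(E4) + the Maass–Selberg families) AND the tube formula of §2 — the `hsNF hPc hPcd hPre hsan
hs_tube` package of the (SD) M1 road in ★ p860445 ∕ ★ p860080 currency (`s := qc default`, `r := (ν𝓕).toReal⁻¹`, `φ' := φ`).
[cite: BernsteinLapid2019, Thm 2.3] [cite: MoeglinWaldspurger1995, II.1.7, IV.1.8–IV.1.11] -/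
theorem exists_scattering_scalar_package_selfDual_m1_cm_three
    (μ : Measure (quasiSplit (↥(maximalRealSubfield L)) L (IsCMField.complexConj L) 3).automorphicQuotient) [(quasiSplit (↥(maximalRealSubfield L)) L (IsCMField.complexConj L) 3).IsAutomorphicMeasure μ]
    (νG : Measure (quasiSplit (↥(maximalRealSubfield L)) L (IsCMField.complexConj L) 3).Adelic) [νG.IsHaarMeasure] [νG.IsInvInvariant] [SFinite νG]
    (ν : Measure ↥(adelicUnipotent (↥(maximalRealSubfield L)) L (IsCMField.complexConj L) 3)) [ν.IsHaarMeasure] [ν.IsMulRightInvariant] [ν.IsInvInvariant]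
    {𝓕 : Set ↥(adelicUnipotent (↥(maximalRealSubfield L)) L (IsCMField.complexConj L) 3)}
    (h𝓕N : IsFundamentalDomain ↥(rationalUnipotent (↥(maximalRealSubfield L)) L (IsCMField.complexConj L) 3) 𝓕 ν) (h𝓕c : IsCompact (closure 𝓕)) (h𝓕₀ : ν 𝓕 ≠ 0)
    {β : (quasiSplit (↥(maximalRealSubfield L)) L (IsCMField.complexConj L) 3).Adelic → ℝ≥0∞}
    (hβ : IsCoveringWeight ↥((arithmeticBorel (↥(maximalRealSubfield L)) L (IsCMField.complexConj L) 3).map (quasiSplit (↥(maximalRealSubfield L)) L (IsCMField.complexConj L) 3).arithmeticSubgroup.subtype) β)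
    {μZ : Measure (borelQuotient (↥(maximalRealSubfield L)) L (IsCMField.complexConj L) 3)} [SFinite μZ]
    (hμZ : ∀ f : borelQuotient (↥(maximalRealSubfield L)) L (IsCMField.complexConj L) 3 → ℝ≥0∞, Measurable f → ∫⁻ z, f z ∂μZ = ∫⁻ g, β g * f (toBorelQuotient (↥(maximalRealSubfield L)) L (IsCMField.complexConj L) 3 g) ∂νG)
    -- the M1 family: `φ ∈ V(χ, K, 1)` continuous bounded with `φ ∘ ι_∞ = φ(1)`, and a basis of `V(χʷ, K, 1)` by continuous bounded functions
    {χ : HeckeCharacter L} {φ : (quasiSplit (↥(maximalRealSubfield L)) L (IsCMField.complexConj L) 3).Adelic → ℂ} (hφV : φ ∈ chiSectionSpace χ ((standardMaximalCompactGL 3 L).comap (adelicVal (↥(maximalRealSubfield L)) L (IsCMField.complexConj L) 3 ((StdForm.antidiagonal 3).over L)) : Subgroup (quasiSplit (↥(maximalRealSubfield L)) L (IsCMField.complexConj L) 3).Adelic) (fun _ => 1)) (hφc : Continuous φ) {Mφ : ℝ} (hφM : ∀ x, ‖φ x‖ ≤ Mφ)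
    (hφinf : ∀ a : arch (↥(maximalRealSubfield L)) L (IsCMField.complexConj L) 3 ((StdForm.antidiagonal 3).over L), φ (archToAdelic (↥(maximalRealSubfield L)) L (IsCMField.complexConj L) 3 _ a) = φ 1)
    (hsd : reflectChar (IsCMField.complexConj L) χ = χ) (hφ1 : φ 1 ≠ 0) :
    ∃ (bV : Module.Basis Unit ℂ ↥(chiSectionSpace (reflectChar (IsCMField.complexConj L) χ) ((standardMaximalCompactGL 3 L).comap (adelicVal (↥(maximalRealSubfield L)) L (IsCMField.complexConj L) 3 ((StdForm.antidiagonal 3).over L)) : Subgroup (quasiSplit (↥(maximalRealSubfield L)) L (IsCMField.complexConj L) 3).Adelic) (fun _ => 1))) (q : Unit → ℂ → ℂ) (Ec : ℂ → (quasiSplit (↥(maximalRealSubfield L)) L (IsCMField.complexConj L) 3).Adelic → ℂ) (qc : Unit → ℂ → ℂ) (P : Set ℂ),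
      (∀ j, ((bV j : ↥(chiSectionSpace (reflectChar (IsCMField.complexConj L) χ) ((standardMaximalCompactGL 3 L).comap (adelicVal (↥(maximalRealSubfield L)) L (IsCMField.complexConj L) 3 ((StdForm.antidiagonal 3).over L)) : Subgroup (quasiSplit (↥(maximalRealSubfield L)) L (IsCMField.complexConj L) 3).Adelic) (fun _ => 1))) : (quasiSplit (↥(maximalRealSubfield L)) L (IsCMField.complexConj L) 3).Adelic → ℂ) = φ) ∧
      ((∀ j, DifferentiableOn ℂ (q j) {z : ℂ | 2 < z.re}) ∧
      (∀ z : ℂ, 2 < z.re → (∑ j, q j z • ((bV j : ↥(chiSectionSpace (reflectChar (IsCMField.complexConj L) χ) ((standardMaximalCompactGL 3 L).comap (adelicVal (↥(maximalRealSubfield L)) L (IsCMField.complexConj L) 3 ((StdForm.antidiagonal 3).over L)) : Subgroup (quasiSplit (↥(maximalRealSubfield L)) L (IsCMField.complexConj L) 3).Adelic) (fun _ => 1))) : (quasiSplit (↥(maximalRealSubfield L)) L (IsCMField.complexConj L) 3).Adelic → ℂ)) = ((((ν 𝓕).toReal⁻¹ : ℝ)) : ℂ) • (fun g : (quasiSplit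 (↥(maximalRealSubfield L)) L (IsCMField.complexConj L) 3).Adelic => (∫ v : ↥(adelicUnipotent (↥(maximalRealSubfield L)) L (IsCMField.complexConj L) 3), flatSectionU φ z ((quasiSplit (↥(maximalRealSubfield L)) L (IsCMField.complexConj L) 3).toAdelic (weylLongU ((IsCMField.complexConj L : L ≃ₐ[↥(maximalRealSubfield L)] L) : L →+* L) (rfl : (StdForm.antidiagonal 3).over L = (StdForm.antidiagonal 3).over L)) * ((v : (quasiSplit (↥(maximalRealSubfield L)) L (IsCMField.complexConj L) 3).Adelic) * g)) ∂ν) * (((borelHeight g : ℝ) : ℂ) ^ (z - 2)))) ∧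
      (∀ g, MeromorphicNFOn (fun z => Ec z g) univ) ∧ (∀ j, MeromorphicNFOn (qc j) univ) ∧
      (∀ z : ℂ, 2 < z.re → Ec z = eisensteinSeriesU (flatSectionU φ z)) ∧ (∀ j (z : ℂ), 2 < z.re → qc j z = q j z) ∧
      IsClosed P ∧ (∀ z₀ : ℂ, ∀ᶠ s in 𝓝[≠] z₀, s ∉ P) ∧ (∀ z ∈ P, z.re ≤ 2) ∧
      (∀ g (z : ℂ), z ∉ P → AnalyticAt ℂ (fun z => Ec z g) z) ∧ (∀ j (z : ℂ), z ∉ P → AnalyticAt ℂ (qc j) z) ∧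
      (∀ g, DifferentiableOn ℂ (fun z => Ec z g) Pᶜ) ∧ (∀ j, DifferentiableOn ℂ (qc j) Pᶜ) ∧
      (∀ z : ℂ, z ∉ P → Continuous (Ec z)) ∧
      ∀ n : ℕ, 1 ≤ n → ∃ U : Set ℂ, IsOpen U ∧ U ⊆ Metric.ball (0 : ℂ) (n + 2) ∧ (∀ z₀ ∈ Metric.ball (0 : ℂ) (n + 2), ∀ᶠ s in 𝓝[≠] z₀, s ∈ U) ∧
        ∃ T₀ : ℝ≥0, 1 ≤ T₀ ∧ ∃ Fam : ℂ → Lp ℂ 2 μ, DifferentiableOn ℂ Fam (U \ P) ∧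
          ∀ z ∈ U \ P, ((Fam z : Lp ℂ 2 μ) : (quasiSplit (↥(maximalRealSubfield L)) L (IsCMField.complexConj L) 3).automorphicQuotient → ℂ) =ᵐ[μ]
            (quasiSplit (↥(maximalRealSubfield L)) L (IsCMField.complexConj L) 3).quotFun (truncation ν 𝓕 T₀ (Ec z))) ∧
      ∀ z : ℂ, 2 < z.re → qc default z = (((ν 𝓕).toReal⁻¹ : ℝ) : ℂ) * ((φ 1)⁻¹ * ∫ v : ↥(adelicUnipotent (↥(maximalRealSubfield L)) L (IsCMField.complexConj L) 3), flatSectionU φ z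
        ((quasiSplit (↥(maximalRealSubfield L)) L (IsCMField.complexConj L) 3).toAdelic (weylLongU (IsCMField.complexConj L : L →+* L)
          (rfl : (StdForm.antidiagonal 3).over L = (StdForm.antidiagonal 3).over L)) * ((v : (quasiSplit (↥(maximalRealSubfield L)) L (IsCMField.complexConj L) 3).Adelic) * 1)) ∂ν) := by
  classical
  have hφ0 : φ ≠ 0 := fun h => hφ1 (by rw [h, Pi.zero_apply])
  obtain ⟨bV, hbV⟩ := exists_basis_singleton_selfDual_maximalLevel_cm L hsd hφV hφ0
  obtain ⟨q, Ec, qc, P, hq, hqφ, hE⟩ := chiEisenstein_family_export_maximalLevel_cm_three L μ νG ν h𝓕N h𝓕c h𝓕₀ hβ hμZ hφV hφc hφM hφinf bV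
    (fun j => by rw [hbV j]; exact hφc) (Mb := Mφ) (fun j x => by rw [hbV j]; exact hφM x)
  refine ⟨bV, q, Ec, qc, P, hbV, ⟨hq, hqφ, hE⟩, ?_⟩
  have hb1 : ((bV default : ↥(chiSectionSpace (reflectChar (IsCMField.complexConj L) χ) ((standardMaximalCompactGL 3 L).comap (adelicVal (↥(maximalRealSubfield L)) L (IsCMField.complexConj L) 3 ((StdForm.antidiagonal 3).over L)) : Subgroup (quasiSplit (↥(maximalRealSubfield L)) L (IsCMField.complexConj L) 3).Adelic) (fun _ => 1))) : (quasiSplit (↥(maximalRealSubfield L)) L (IsCMField.complexConj L) 3).Adelic → ℂ) 1 ≠ 0 := by rw [hbV]; exact hφ1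
  have h := scatteringScalar_tube_of_coords_three L ν (fun j => ((bV j : ↥(chiSectionSpace (reflectChar (IsCMField.complexConj L) χ) ((standardMaximalCompactGL 3 L).comap (adelicVal (↥(maximalRealSubfield L)) L (IsCMField.complexConj L) 3 ((StdForm.antidiagonal 3).over L)) : Subgroup (quasiSplit (↥(maximalRealSubfield L)) L (IsCMField.complexConj L) 3).Adelic) (fun _ => 1))) : (quasiSplit (↥(maximalRealSubfield L)) L (IsCMField.complexConj L) 3).Adelic → ℂ)) hqφ hE.2.2.2.1 hb1
  simpa only [hbV] using h

end Summit.HodgeConjecture.HodgeConjecture.Cruxes.H413.K2E1ChiScatteringScalarPackageM1CMThree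

end
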